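import Mathlib
import Summits.Ventures.PercRepro2.CoinChainXAJpGate
import Summits.Ventures.PercRepro2.CoinChainXAJpGateB
import Summits.Ventures.PercRepro2.CoinChainXACross
import Summits.Ventures.PercRepro2.CoinChainXAGateHull

/-!
# (XA′) for the coin-entered markers `(j, j')` and EVERY admissible gate — the two families united
(blind cell PercRepro2, night-2 g29; proofs/NIGHT2-DARC.md §71)

`chain_XA'_jp`: for `ent = {m}`, `ent' = {j, j'}`, the markers `x = 1[j ∈ ·]`, `y = 1[j' ∈ ·]` and ANY gate `d'`
(standing hypotheses), given positive `d`-masses on the fibres `mjj'`, `jj'` and a positive `c`-mass on the fibre `∅`,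
the cleared (XA′) `Cross ≤ a0·U001` holds — family A (`chain_XA'_jp_A`, `γ_m ≥ 0`) or family B (`chain_XA'_jp_B`,
`γ_m ≤ 0`) by the sign of the coefficient `γ_m` of the `m`-fibre gate mass.  `chain_functional_nonneg_jp`: the AND-switch
chain at every `ρ ∈ [0, 1]` with that gate (`chain_functional_nonneg_of_XA'`).
-/

namespace Summit.Ventures.PercRepro2.Coin

open Classical

section JpGateAll

variable {V : Type*} [DecidableEq V] {R : Type*} [Field R] [LinearOrder R] [IsStrictOrderedRing R]

set_option maxHeartbeats 3200000 in
/-- **(XA′) FOR THE MARKERS `(j, j')` AND EVERY ADMISSIBLE GATE** (positive masses on the fibres `mjj'`, `jj'` (coin law)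
and `∅` (closed law)): the union of the two sign families. -/
theorem chain_XA'_jp (U : Finset V) (m j j' : V) (ν c d d' : Finset V → R)
    (hν0 : ∀ W, 0 ≤ ν W) (hν : ∀ s ⊆ U, ∀ t ⊆ U, ν s * ν t ≤ ν (s ∩ t) * ν (s ∪ t))
    (hc0 : ∀ W, 0 ≤ c W) (hd0 : ∀ W, 0 ≤ d W) (hd'0 : ∀ W, 0 ≤ d' W) (hdc : ∀ W, d W ≤ c W) (hd'd : ∀ W, d' W ≤ d W)
    (hcc : ∀ s t, c s * c t ≤ c (s ∩ t) * c (s ∪ t))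
    (hdd : ∀ s t, d s * d t ≤ d (s ∩ t) * d (s ∪ t))
    (hd'd' : ∀ s t, d' s * d' t ≤ d' (s ∩ t) * d' (s ∪ t))
    (hcd : ∀ s t, c s * d t ≤ c (s ∩ t) * d (s ∪ t))
    (hdd' : ∀ s t, d s * d' t ≤ d (s ∩ t) * d' (s ∪ t))
    (hU : 0 < ∑ W ∈ U.powerset.filter (fun W => m ∈ W ∧ j ∈ W ∧ j' ∈ W), ν W * d W)
    (hJJ : 0 < ∑ W ∈ U.powerset.filter (fun W => m ∉ W ∧ j ∈ W ∧ j' ∈ W), ν W * d W)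
    (hO : 0 < ∑ W ∈ U.powerset.filter (fun W => m ∉ W ∧ j ∉ W ∧ j' ∉ W), ν W * c W)
    (x y : Finset V → R) (hx : ∀ W, x W = if j ∈ W then 1 else 0)
    (hy : ∀ W, y W = if j' ∈ W then 1 else 0) :
    (((∑ W ∈ U.powerset, ν W * chainMix {m} {j, j'} 0 c d W) * (∑ W ∈ U.powerset, ν W * chainMix {m} {j, j'} 1 c d W * x W) - (∑ W ∈ U.powerset, ν W * chainMix {m} {j, j'} 0 c d W * x W) * (∑ W ∈ U.powerset, ν W * chainMix {m} {j, j'} 1 c d W)) *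
          ((∑ W ∈ U.powerset, ν W * chainMix {m} {j, j'} 0 c d W) * (∑ W ∈ U.powerset, ν W * chainMix {m} {j, j'} 0 c d' W * y W) - (∑ W ∈ U.powerset, ν W * chainMix {m} {j, j'} 0 c d W * y W) * (∑ W ∈ U.powerset, ν W * chainMix {m} {j, j'} 0 c d' W))
        + ((∑ W ∈ U.powerset, ν W * chainMix {m} {j, j'} 0 c d W) * (∑ W ∈ U.powerset, ν W * chainMix {m} {j, j'} 1 c d W * y W) - (∑ W ∈ U.powerset, ν W * chainMix {m} {j, j'} 0 c d W * y W) * (∑ W ∈ U.powerset, ν W * chainMix {m} {j, j'} 1 c d W)) *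
          ((∑ W ∈ U.powerset, ν W * chainMix {m} {j, j'} 0 c d W) * (∑ W ∈ U.powerset, ν W * chainMix {m} {j, j'} 0 c d' W * x W) - (∑ W ∈ U.powerset, ν W * chainMix {m} {j, j'} 0 c d W * x W) * (∑ W ∈ U.powerset, ν W * chainMix {m} {j, j'} 0 c d' W))) ≤
        (∑ W ∈ U.powerset, ν W * chainMix {m} {j, j'} 0 c d W) * ((∑ W ∈ U.powerset, ν W * chainMix {m} {j, j'} 0 c d W) * (∑ W ∈ U.powerset, ν W * chainMix {m} {j, j'} 0 c d W) * (∑ W ∈ U.powerset, ν W * chainMix {m} {j, j'} 1 c d' W * (x W * y W))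
          - (∑ W ∈ U.powerset, ν W * chainMix {m} {j, j'} 0 c d W) * (∑ W ∈ U.powerset, ν W * chainMix {m} {j, j'} 0 c d W * y W) * (∑ W ∈ U.powerset, ν W * chainMix {m} {j, j'} 1 c d' W * x W)
          - (∑ W ∈ U.powerset, ν W * chainMix {m} {j, j'} 0 c d W) * (∑ W ∈ U.powerset, ν W * chainMix {m} {j, j'} 0 c d W * x W) * (∑ W ∈ U.powerset, ν W * chainMix {m} {j, j'} 1 c d' W * y W)
          + (∑ W ∈ U.powerset, ν W * chainMix {m} {j, j'} 0 c d W * x W) * (∑ W ∈ U.powerset, ν W * chainMix {m} {j, j'} 0 c d W * y W) * (∑ W ∈ U.powerset, ν W * chainMix {m} {j, j'} 1 c d' W)) :=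
  (le_total (0 : R) _).elim
    (fun h => chain_XA'_jp_A U m j j' ν c d d' hν0 hν hc0 hd0 hd'0 hdc hd'd hcc hdd hd'd' hcd hdd'
      _ _ _ _ _ _ _ _ _ _ _ _ _ _ _ _ rfl rfl rfl rfl rfl rfl rfl rfl rfl rfl rfl rfl rfl rfl rfl rfl h hU hJJ hO x y hx hy)
    (fun h => chain_XA'_jp_B U m j j' ν c d d' hν0 hν hc0 hd0 hd'0 hdc hd'd hcc hdd hd'd' hcd hdd'
      _ _ _ _ _ _ _ _ _ _ _ _ _ _ _ _ rfl rfl rfl rfl rfl rfl rfl rfl rfl rfl rfl rfl rfl rfl rfl rfl h hU hJJ x y hx hy)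

/-- **THE AND-SWITCH CHAIN WITH ONE SURE ENTRY `m`, THE COIN ENTRIES `{j, j'}` AND THE MARKERS `(j, j')`, AT EVERY
`ρ ∈ [0, 1]`, FOR EVERY ADMISSIBLE GATE**: the chain functional of `chain_functional_nonneg_of_XA'` is nonnegative
(standing hypotheses; positive world masses and ideal mass; positive `d`-masses on the fibres `mjj'` and `jj'`, positive
`c`-mass on the fibre `∅`). -/
theorem chain_functional_nonneg_jp (U : Finset V) (m j j' : V)
    (ν c d d' : Finset V → R)
    (ρ : R) (hρ0 : 0 ≤ ρ) (hρ1 : ρ ≤ 1) (hν0 : ∀ W, 0 ≤ ν W)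
    (hν : ∀ s ⊆ U, ∀ t ⊆ U, ν s * ν t ≤ ν (s ∩ t) * ν (s ∪ t))
    (hc0 : ∀ W, 0 ≤ c W) (hd0 : ∀ W, 0 ≤ d W) (hd'0 : ∀ W, 0 ≤ d' W)
    (hdc : ∀ W, d W ≤ c W) (hd'c : ∀ W, d' W ≤ c W) (hd'd : ∀ W, d' W ≤ d W)
    (hcc : ∀ s t, c s * c t ≤ c (s ∩ t) * c (s ∪ t))
    (hdd : ∀ s t, d s * d t ≤ d (s ∩ t) * d (s ∪ t))
    (hd'd' : ∀ s t, d' s * d' t ≤ d' (s ∩ t) * d' (s ∪ t))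
    (hcd : ∀ s t, c s * d t ≤ c (s ∩ t) * d (s ∪ t))
    (hcd' : ∀ s t, c s * d' t ≤ c (s ∩ t) * d' (s ∪ t))
    (hdd' : ∀ s t, d s * d' t ≤ d (s ∩ t) * d' (s ∪ t))
    (hratio : ∀ s t, s ⊆ t → d s * c t ≤ c s * d t)
    (hratio' : ∀ s t, s ⊆ t → d' s * c t ≤ c s * d' t)
    (x y : Finset V → R) (hx : ∀ W, x W = if j ∈ W then 1 else 0)
    (hy : ∀ W, y W = if j' ∈ W then 1 else 0)
    (hpos0 : 0 < ∑ W ∈ U.powerset, ν W * chainMix {m} {j, j'} 0 c d W)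
    (hpos1 : 0 < ∑ W ∈ U.powerset, ν W * chainMix {m} {j, j'} 1 c d W)
    (hmI : 0 < ∑ W ∈ U.powerset.filter (fun W => ¬ ∃ r ∈ ({m} : Finset V) ∪ {j, j'}, r ∈ W), ν W * c W)
    (hU : 0 < ∑ W ∈ U.powerset.filter (fun W => m ∈ W ∧ j ∈ W ∧ j' ∈ W), ν W * d W)
    (hJJ : 0 < ∑ W ∈ U.powerset.filter (fun W => m ∉ W ∧ j ∈ W ∧ j' ∈ W), ν W * d W)
    (hO : 0 < ∑ W ∈ U.powerset.filter (fun W => m ∉ W ∧ j ∉ W ∧ j' ∉ W), ν W * c W) :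
    0 ≤ (∑ W ∈ U.powerset, ν W * chainMix {m} {j, j'} ρ c d W) ^ 2 *
          (∑ W ∈ U.powerset, ν W * chainMix {m} {j, j'} ρ c d' W * (x W * y W))
        - (∑ W ∈ U.powerset, ν W * chainMix {m} {j, j'} ρ c d W) *
          (∑ W ∈ U.powerset, ν W * chainMix {m} {j, j'} ρ c d W * x W) *
          (∑ W ∈ U.powerset, ν W * chainMix {m} {j, j'} ρ c d' W * y W)
        - (∑ W ∈ U.powerset, ν W * chainMix {m} {j, j'} ρ c d W) *
          (∑ W ∈ U.powerset, ν W * chainMix {m} {j, j'} ρ c d W * y W) *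
          (∑ W ∈ U.powerset, ν W * chainMix {m} {j, j'} ρ c d' W * x W)
        + (∑ W ∈ U.powerset, ν W * chainMix {m} {j, j'} ρ c d W * x W) *
          (∑ W ∈ U.powerset, ν W * chainMix {m} {j, j'} ρ c d W * y W) *
          (∑ W ∈ U.powerset, ν W * chainMix {m} {j, j'} ρ c d' W) :=
  chain_functional_nonneg_of_XA' U {m} {j, j'} ν c d d' ρ hρ0 hρ1 hν0 hν hc0 hd0 hd'0 hdc hd'c hd'd
    hcc hdd hd'd' hcd hcd' hdd' hratio hratio' x y (marker_nonneg j x hx) (marker_nonneg j' y hy)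
    (marker_mono j x hx) (marker_mono j' y hy) hpos0 hpos1 hmI
    (chain_XA'_jp U m j j' ν c d d' hν0 hν hc0 hd0 hd'0 hdc hd'd hcc hdd hd'd' hcd hdd' hU hJJ hO x y hx hy)

end JpGateAll

end Summit.Ventures.PercRepro2.Coin
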